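import Summits.QuantumFields.YangMills.Theorems.SamplerStabilityBernsteinRateConditionalBernsteinCM
import Summits.QuantumFields.YangMills.Theorems.SpecificationCompactnessUnitDensityPosAE
import Literature.MathematicalPhysics.QuantumFieldTheory.Balaban1983to89.T3UnitLawDensityEML
import HarnessLib

/-!
# Crux `SpecificationRate` (stmt-QuantumFields-28041, route `SamplerStability`), LINE 12 «bernstein_rate» v2 (planner ym-idea-5 g9/g15):
# STUB 1 `stub_mutualDensity` — CONSECUTIVE RENORMALISED UNIT LAWS ARE MUTUALLY ABSOLUTELY CONTINUOUS WITH A POSITIVE DENSITY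

The registered STUB 1 of the «bernstein_rate» skeleton (sha ea217006…; shared verbatim with LINE 11 «conditional_hellinger»):
`∃ γ₁ > 0, ∀ F γ, 0 < γ ≤ γ₁ → ∃ K₀, ∀ K ≥ K₀, ∃ h, Measurable h ∧ (∀ V, 0 < h V) ∧ ρ_{K+1} = ρ_K.withDensity h`, `ρ_K` the renormalised
unit law of the family at parameter `γ` (`rho F γ K = F.unitLaw expMeanLogSU _ γ K`).  It holds for EVERY `γ > 0` and EVERY `K` (`γ₁ := 1`,
`K₀ := 0`), from three tree facts: the unit law HAS the density `Z_K⁻¹ρ̂_K` w.r.t. product Haar on the unit torus, hypothesis-free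
(`T3UnitLawDensityEML.unitLaw_eq_withDensity_emlDensity`, [Balaban1985UV3] (2) p.256 + (6) p.257); `ρ̂_K > 0` product-Haar-a.e.
(`UnitDensityPosAE.unitDensity_pos_ae`, p655226); `Z_K > 0` (`Missing.partitionFn_pos'`).  §1 is the generic measure-theory step: two
`withDensity` measures over one reference measure with measurable, a.e.-positive real densities `d₁, d₂` differ by the measurable,
EVERYWHERE-positive density `h = d₂/d₁` on `{0 < d₁} ∩ {0 < d₂}`, `h = 1` elsewhere (`withDensity_mul` + `withDensity_congr_ae`).
§3 is the stub BY NAME (`__Registered.stub_mutualDensity` of the landed abbrev module `…SamplerStabilityBernsteinRateConditionalBernsteinCM`,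
w3 g29 p-landed 20:39Z; the skeleton's `rho`/`X0`/`avSU` unfold to the tree's `unitLaw`/`GaugeField`/`ℰp` by `rfl`).

Width seat ym-line-sfw-p2-w5 g11 (cell ym-idea-1; free hands), planner-of-record ym-idea-5 g15 (LANDABLE-NOW-g15 §4.4, critic idea-crit-5
NOTE #165 order), `--supports stmt-QuantumFields-28041`.  THEOREMS ONLY.  HONEST FRAMING: [folklore] bookkeeping; the line's content is STUB 2
(`stub_logIncrementCondVariance`, XL, OPEN); no crux, rung (SS is a RECORD-rung ladder) or summit is proved; the Yang–Mills mass gap is NOT proved.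
-/

set_option autoImplicit false

noncomputable section

namespace Summit.QuantumFields.YangMills.Theorems.SamplerStability.MutualDensity

open MeasureTheory
open Literature.MathematicalPhysics.QuantumFieldTheory
open Literature.MathematicalPhysics.QuantumFieldTheory.Balaban1983to89
open Literature.MathematicalPhysics.QuantumFieldTheory.Balaban1983to89.T3ContinuumYM3Torus
open Literature.MathematicalPhysics.QuantumFieldTheory.Balaban1983to89.T3UnitLawDensityEML
open Literature.MathematicalPhysics.QuantumFieldTheory.Balaban1983to89.Missing

/-! ## §1 Generic: two measures with a.e.-positive real densities w.r.t. one reference measure -/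

/-- **A positive-everywhere density between two `withDensity` measures.**  If `μ₁ = π.withDensity d₁`, `μ₂ = π.withDensity d₂` with `d₁, d₂`
measurable, non-negative and positive `π`-a.e., then `h := d₂/d₁` on `{0 < d₁} ∩ {0 < d₂}` and `h := 1` elsewhere is measurable, positive
EVERYWHERE, and `μ₂ = μ₁.withDensity h`. [folklore] -/
theorem exists_pos_density_of_withDensity {X : Type*} [MeasurableSpace X] (π : Measure X) {d₁ d₂ : X → ℝ}
    (hm₁ : Measurable d₁) (hm₂ : Measurable d₂) (h0₁ : ∀ x, 0 ≤ d₁ x)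
    (hp₁ : ∀ᵐ x ∂π, 0 < d₁ x) (hp₂ : ∀ᵐ x ∂π, 0 < d₂ x) :
    ∃ h : X → ℝ, Measurable h ∧ (∀ x, 0 < h x) ∧
      π.withDensity (fun x => ENNReal.ofReal (d₂ x)) =
        (π.withDensity (fun x => ENNReal.ofReal (d₁ x))).withDensity (fun x => ENNReal.ofReal (h x)) := by
  classical
  set H : X → ℝ := fun x => if 0 < d₁ x ∧ 0 < d₂ x then d₂ x / d₁ x else 1 with hH
  have hmH : Measurable H :=
    Measurable.ite ((measurableSet_lt measurable_const hm₁).inter (measurableSet_lt measurable_const hm₂))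
      (hm₂.div hm₁) measurable_const
  have hposH : ∀ x, 0 < H x := by
    intro x
    show 0 < (if 0 < d₁ x ∧ 0 < d₂ x then d₂ x / d₁ x else 1)
    split_ifs with hx
    · exact div_pos hx.2 hx.1
    · exact one_pos
  refine ⟨H, hmH, hposH, ?_⟩
  have hmd₁ : Measurable fun x => ENNReal.ofReal (d₁ x) := ENNReal.measurable_ofReal.comp hm₁
  have hmH' : Measurable fun x => ENNReal.ofReal (H x) := ENNReal.measurable_ofReal.comp hmH
  rw [← withDensity_mul π hmd₁ hmH']
  refine withDensity_congr_ae ?_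
  filter_upwards [hp₁, hp₂] with x hx₁ hx₂
  show ENNReal.ofReal (d₂ x) = ENNReal.ofReal (d₁ x) * ENNReal.ofReal (H x)
  rw [← ENNReal.ofReal_mul (h0₁ x)]
  congr 1
  show d₂ x = d₁ x * (if 0 < d₁ x ∧ 0 < d₂ x then d₂ x / d₁ x else 1)
  rw [if_pos ⟨hx₁, hx₂⟩]
  field_simp

/-! ## §2 Consecutive renormalised unit laws of a `T3Family` (`SU(2)`, `ℰ = expMeanLogSU`, `γ > 0`) -/

/-- **CONSECUTIVE RENORMALISED UNIT LAWS ARE MUTUALLY A.C. WITH A POSITIVE MEASURABLE DENSITY** — for every `T3Family F`, every `γ > 0`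
and every `K` there is a measurable `h > 0` (everywhere) with `unitLaw (K+1) = (unitLaw K).withDensity h`.  Ingredients, all in the tree:
`unitLaw K = dV_{T₁}.withDensity (Z_K⁻¹ρ̂_K)` hypothesis-free (`T3UnitLawDensityEML.unitLaw_eq_withDensity_emlDensity`), `ρ̂_K > 0` a.e.
(`UnitDensityPosAE.unitDensity_pos_ae`), `Z_K > 0` (`partitionFn_pos'`), and §1. [cite: Balaban1985UV3, (2) p.256 + (6) p.257] -/
theorem exists_pos_density_unitLaw (F : T3Family) {γ : ℝ} (hγ : 0 < γ) (K : ℕ) :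
    ∃ h : GaugeField (F.P 0) 0 (Matrix.specialUnitaryGroup (Fin 2) ℂ) → ℝ, Measurable h ∧ (∀ V, 0 < h V) ∧
      F.unitLaw ℰp measurableE_ℰp γ (K + 1) =
        (F.unitLaw ℰp measurableE_ℰp γ K).withDensity (fun V => ENNReal.ofReal (h V)) := by
  have hZ : ∀ K', 0 < partitionFn (G := Matrix.specialUnitaryGroup (Fin 2) ℂ) (F.P K') ((F.scheme ℰp γ).β K') := fun K' =>
    partitionFn_pos' _ (F.scheme_β_nonneg ℰp hγ.le K')
  obtain ⟨hm₁, h0₁, -⟩ := unitDensity_props F K hγ.le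
  obtain ⟨hm₂, -, -⟩ := unitDensity_props F (K + 1) hγ.le
  have hp₁ : ∀ᵐ u ∂(fieldMeasure (F.P 0) 0 (Matrix.specialUnitaryGroup (Fin 2) ℂ)),
      0 < (partitionFn (G := Matrix.specialUnitaryGroup (Fin 2) ℂ) (F.P K) ((F.scheme ℰp γ).β K))⁻¹ * unitDensity F γ K u := by
    filter_upwards [UnitDensityPosAE.unitDensity_pos_ae F γ hγ K] with u hu
    exact mul_pos (inv_pos.mpr (hZ K)) hu
  have hp₂ : ∀ᵐ u ∂(fieldMeasure (F.P 0) 0 (Matrix.specialUnitaryGroup (Fin 2) ℂ)),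
      0 < (partitionFn (G := Matrix.specialUnitaryGroup (Fin 2) ℂ) (F.P (K + 1)) ((F.scheme ℰp γ).β (K + 1)))⁻¹ *
        unitDensity F γ (K + 1) u := by
    filter_upwards [UnitDensityPosAE.unitDensity_pos_ae F γ hγ (K + 1)] with u hu
    exact mul_pos (inv_pos.mpr (hZ (K + 1))) hu
  obtain ⟨h, hmeas, hpos, heq⟩ := exists_pos_density_of_withDensity
    (fieldMeasure (F.P 0) 0 (Matrix.specialUnitaryGroup (Fin 2) ℂ)) (hm₁.const_mul _) (hm₂.const_mul _)
    (fun u => mul_nonneg (inv_nonneg.mpr (hZ K).le) (h0₁ u)) hp₁ hp₂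
  refine ⟨h, hmeas, hpos, ?_⟩
  rw [unitLaw_eq_withDensity_emlDensity F (K + 1) hγ.le, unitLaw_eq_withDensity_emlDensity F K hγ.le]
  exact heq

end Summit.QuantumFields.YangMills.Theorems.SamplerStability.MutualDensity

/-! ## §3 STUB 1 of LINE 12 «bernstein_rate» (crux stmt-QuantumFields-28041), registered name and statement -/

namespace Summit.QuantumFields.YangMills.Cruxes.SpecificationRate.BernsteinRate

/-- **STUB 1 `stub_mutualDensity` (registered, `__Registered.stub_mutualDensity = MutualDensity`)**: consecutive renormalised unit laws
`ρ_K, ρ_{K+1}` of every `T3Family` at every `γ ∈ (0, 1]` are mutually absolutely continuous with a measurable, everywhere-positive density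
(`γ₁ := 1`, `K₀ := 0`; §2 `exists_pos_density_unitLaw`). [cite: Balaban1985UV3, (2) p.256 + (6) p.257] -/
theorem stub_mutualDensity : __Registered.stub_mutualDensity :=
  ⟨1, one_pos, fun F _γ hγ _ => ⟨0, fun K _ =>
    Summit.QuantumFields.YangMills.Theorems.SamplerStability.MutualDensity.exists_pos_density_unitLaw F hγ K⟩⟩

end Summit.QuantumFields.YangMills.Cruxes.SpecificationRate.BernsteinRate
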